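import Mathlib.AlgebraicGeometry.EllipticCurve.Affine.Point
import Mathlib.NumberTheory.LegendreSymbol.QuadraticChar.Basic
import Mathlib.FieldTheory.Finite.Basic
import HarnessLib

/-!
# `#E(𝔽_q) ≡ 1 - A_q (mod p)`: the number of points and the Hasse invariant (Silverman AEC V.4.1(a);
# proofs only)

Trunk T-NT-EC (Literature/NumberTheory/EllipticCurves). Support file for the uniqueness half of the
named fact `WeierstrassCurve.mazur_tate_sigma_existsUnique` (`PadicSigma.lean`), whose hypothesis
"`p ∤ a_p`" (ordinary reduction, `a_p = p + 1 - #Ẽ(𝔽_p)`, the tree's `frobeniusTrace`) has to be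
turned into the non-vanishing of the Hasse invariant `A_p mod p` (consumed through
`FormalGroupHasseInvariantProofs.lean`: `A_p` is the coefficient of `z^{p-1}` of the invariant
differential). This file proves, for a Weierstrass equation `W` over a finite field `𝔽` with `q`
elements and odd characteristic:

* `WeierstrassCurve.cast_natCard_equation_eq` — **`#{(x, y) ∈ 𝔽² : y² + a₁xy + a₃y = x³ + ⋯}
  = -A_q` in `𝔽`**, where `A_q` is the coefficient of `x^{q-1}` in
  `(4x³ + b₂x² + 2b₄x + b₆)^{(q-1)/2} = Ψ₂²(x)^{(q-1)/2}` (Mathlib's `twoTorsionPolynomial`; for a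
  general equation the discriminant of the quadratic in `y` is `Ψ₂²(x) = (2y + a₁x + a₃)²`);
* `WeierstrassCurve.cast_natCard_point_eq` — **AEC V.4.1(a): `#E(𝔽_q) = 1 - A_q` in `𝔽_q`** for an
  elliptic `W` (all affine points nonsingular), with `#E(𝔽_q) = Nat.card W.toAffine.Point`;
* `WeierstrassCurve.cast_card_add_one_sub_natCard_point` — equivalently the trace of Frobenius
  `a = q + 1 - #E(𝔽_q)` satisfies **`a = A_q` in `𝔽_q`** ("`a = A_q` as an equality in `𝔽_q`",
  AEC p. 149), so `p ∣ a ↔ A_q = 0`.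

The proof is Silverman's: `#{y : (2y + B)² = D} = 1 + χ(D)` (`quadraticChar_card_sqrts`),
`χ(D) = D^{(q-1)/2}` in `𝔽` (Euler's criterion, `quadraticChar_eq_pow_of_char_ne_two'`), and
`Σ_{x ∈ 𝔽} x^i = 0` unless `q - 1 ∣ i > 0` (`FiniteField.sum_pow_units`), so that summing the
polynomial `Ψ₂²(x)^{(q-1)/2}` (degree `3(q-1)/2 < 2(q-1)`) over `𝔽` leaves `-A_q`.

## Sources

* J. H. Silverman, *The Arithmetic of Elliptic Curves*, 2nd ed. (2009), Thm. V.4.1(a) and its proof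
  (PDF p. 149: `Σ_{x ∈ 𝔽_q} x^i`, `A_q`, "`#E(𝔽_q) = 1 - A_q` … `a = A_q`"). [SilvermanAEC2009]

## Design notes

Stated for any finite field of odd characteristic and any (long) Weierstrass equation; the Hasse
coefficient is written out as `(W.twoTorsionPolynomial.toPoly ^ ((q - 1) / 2)).coeff (q - 1)`, which
is `WeierstrassCurve.hasseCoeff W q` of `FormalGroupHasseInvariantProofs.lean` (kept import-free
here). No definitions, no named facts.
-/

noncomputable section

open Finset Polynomial

namespace Literature.NumberTheory.EllipticCurves

/-! ### Power sums over a finite field -/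

section PowerSums

variable {K : Type*} [Field K] [Fintype K]

/-- `Σ_{x ∈ 𝔽} xⁱ = Σ_{x ∈ 𝔽ˣ} xⁱ` for `i > 0`, hence `= -1` if `q - 1 ∣ i` and `0` otherwise.
[Silverman AEC V.4.1 (proof)] [folklore] -/
theorem sum_pow_eq_of_pos {i : ℕ} (hi : 0 < i) :
    ∑ x : K, x ^ i = if Fintype.card K - 1 ∣ i then -1 else 0 := by
  classical
  let φ : Kˣ ↪ K := ⟨fun x ↦ x, Units.val_injective⟩
  have hφ : univ.map φ = univ \ {0} := by
    ext x
    simpa only [mem_map, mem_univ, Function.Embedding.coeFn_mk, true_and, mem_sdiff,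
      mem_singleton, φ] using! isUnit_iff_ne_zero
  calc ∑ x : K, x ^ i = ∑ x ∈ univ \ {(0 : K)}, x ^ i := by
        rw [← sum_sdiff ({0} : Finset K).subset_univ, sum_singleton, zero_pow hi.ne', add_zero]
    _ = ∑ x : Kˣ, (x ^ i : K) := by simp [φ, ← hφ, univ.sum_map φ]
    _ = _ := FiniteField.sum_pow_units K i

/-- For `i < 2(q - 1)`: `Σ_{x ∈ 𝔽} xⁱ = -1` if `i = q - 1` and `0` otherwise (including `i = 0`,
where the sum is `q = 0`). [Silverman AEC V.4.1 (proof)] [folklore] -/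
theorem sum_pow_eq_ite {i : ℕ} (hi : i < 2 * (Fintype.card K - 1)) :
    ∑ x : K, x ^ i = if i = Fintype.card K - 1 then -1 else 0 := by
  have hq : 1 < Fintype.card K := Fintype.one_lt_card
  rcases Nat.eq_zero_or_pos i with rfl | hpos
  · rw [if_neg (by omega)]
    simp
  · rw [sum_pow_eq_of_pos hpos]
    by_cases h : i = Fintype.card K - 1
    · rw [if_pos h, if_pos (h ▸ dvd_refl _)]
    · rw [if_neg h, if_neg]
      rintro ⟨c, hc⟩
      rcases Nat.lt_or_ge c 2 with hc2 | hc2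
      · interval_cases c <;> omega
      · have : (Fintype.card K - 1) * c ≥ (Fintype.card K - 1) * 2 := Nat.mul_le_mul_left _ hc2
        omega

/-- **Summing a polynomial of degree `< 2(q-1)` over `𝔽_q` picks out `-[x^{q-1}]`.**
[Silverman AEC V.4.1 (proof: "the only nonzero term comes from `x^{q-1}`")] [folklore] -/
theorem sum_eval_eq_neg_coeff (P : K[X]) (hP : P.natDegree < 2 * (Fintype.card K - 1)) :
    ∑ x : K, P.eval x = -P.coeff (Fintype.card K - 1) := by
  have hq : 1 < Fintype.card K := Fintype.one_lt_card
  simp_rw [eval_eq_sum_range' (lt_of_lt_of_le (Nat.lt_succ_self _) le_rfl : P.natDegree < P.natDegree + 1)]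
  rw [sum_comm]
  have h : ∀ i ∈ range (P.natDegree + 1), ∑ x : K, P.coeff i * x ^ i =
      if i = Fintype.card K - 1 then -P.coeff i else 0 := by
    intro i hi
    rw [← mul_sum, sum_pow_eq_ite (lt_of_lt_of_le (mem_range.mp hi) (by omega))]
    split_ifs <;> simp
  rw [sum_congr rfl h, sum_ite_eq']
  split_ifs with hmem
  · rfl
  · have hlt : P.natDegree < Fintype.card K - 1 := by
      rw [mem_range, not_lt] at hmem
      omega
    rw [coeff_eq_zero_of_natDegree_lt hlt, neg_zero]

end PowerSums

end Literature.NumberTheory.EllipticCurves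

namespace WeierstrassCurve

open Literature.NumberTheory.EllipticCurves

variable {K : Type*} [Field K] [Fintype K] (W : WeierstrassCurve K)

omit [Fintype K] in
/-- `Ψ₂²(x) = 4x³ + b₂x² + 2b₄x + b₆` evaluated (the name `eval_twoTorsionPolynomial` is taken by
the `ℝ`-case in `RealPeriod.lean`; this is the same computation over any field). [folklore] -/
private theorem eval_twoTorsionPolynomial' (x : K) :
    W.twoTorsionPolynomial.toPoly.eval x = 4 * x ^ 3 + W.b₂ * x ^ 2 + 2 * W.b₄ * x + W.b₆ := by
  simp [twoTorsionPolynomial, Cubic.toPoly]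

omit [Fintype K] in
/-- **The fibre over `x`**: `y ↦ 2y + a₁x + a₃` identifies the solutions `y` of the Weierstrass
equation at `x` with the square roots of `Ψ₂²(x) = (2y + a₁x + a₃)²` (odd characteristic).
[Silverman AEC III.1 (completing the square), V.4.1] [folklore] -/
theorem card_equation_fibre_eq (h2 : ringChar K ≠ 2) (x : K) :
    Nat.card {y : K // W.toAffine.Equation x y} =
      Nat.card {u : K // u ^ 2 = W.twoTorsionPolynomial.toPoly.eval x} := by
  have h2' : (2 : K) ≠ 0 := Ring.two_ne_zero h2
  let e : K ≃ K := (Units.mk0 (2 : K) h2').mulLeft.trans (Equiv.addRight (W.a₁ * x + W.a₃))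
  refine Nat.card_congr (e.subtypeEquiv fun y => ?_)
  change W.toAffine.Equation x y ↔ (2 * y + (W.a₁ * x + W.a₃)) ^ 2 = W.twoTorsionPolynomial.toPoly.eval x
  rw [Affine.equation_iff, eval_twoTorsionPolynomial']
  have h4 : (4 : K) ≠ 0 := by
    rw [show (4 : K) = 2 * 2 by norm_num]; exact mul_ne_zero h2' h2'
  constructor
  · intro h
    simp only [b₂, b₄, b₆]
    linear_combination 4 * h
  · intro h
    simp only [b₂, b₄, b₆] at h
    have : (4 : K) * (y ^ 2 + W.a₁ * x * y + W.a₃ * y - (x ^ 3 + W.a₂ * x ^ 2 + W.a₄ * x + W.a₆)) = 0 := by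
      linear_combination h
    rcases mul_eq_zero.mp this with h0 | h0
    · exact absurd h0 h4
    · exact sub_eq_zero.mp h0

/-- `#{u : u² = a} = 1 + χ(a)`, cast into `𝔽`: `= 1 + a^{(q-1)/2}` (Euler's criterion).
[Silverman AEC V.4.1 (proof)] [folklore] -/
theorem _root_.Literature.NumberTheory.EllipticCurves.cast_card_sqrts (h2 : ringChar K ≠ 2) (a : K) :
    (Nat.card {u : K // u ^ 2 = a} : K) = 1 + a ^ (Fintype.card K / 2) := by
  classical
  have h := quadraticChar_card_sqrts h2 a
  rw [Set.toFinset_card, ← Nat.card_eq_fintype_card] at h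
  have h' : (Nat.card {u : K // u ^ 2 = a} : ℤ) = quadraticChar K a + 1 := h
  have h'' := congrArg (Int.cast : ℤ → K) h'
  push_cast at h''
  rw [h'', quadraticChar_eq_pow_of_char_ne_two' h2 a, add_comm]

/-- **`#{(x, y) ∈ 𝔽² on W} = -A_q` in `𝔽`** (`q = #𝔽` odd): the affine point count is
`Σₓ (1 + Ψ₂²(x)^{(q-1)/2}) = q - A_q`. [Silverman AEC V.4.1(a) (proof)] [cite: SilvermanAEC2009, V.4.1] -/
theorem cast_natCard_equation_eq (h2 : ringChar K ≠ 2) :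
    (Nat.card {xy : K × K // W.toAffine.Equation xy.1 xy.2} : K) =
      -(W.twoTorsionPolynomial.toPoly ^ ((Fintype.card K - 1) / 2)).coeff (Fintype.card K - 1) := by
  classical
  have hq1 : 1 < Fintype.card K := Fintype.one_lt_card
  have hodd : Fintype.card K % 2 = 1 := FiniteField.odd_card_of_char_ne_two h2
  have hhalf : Fintype.card K / 2 = (Fintype.card K - 1) / 2 := by omega
  -- fibrewise count
  have h1 : Nat.card {xy : K × K // W.toAffine.Equation xy.1 xy.2} =
      ∑ x : K, Nat.card {y : K // W.toAffine.Equation x y} := by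
    rw [Nat.card_congr (Equiv.subtypeProdEquivSigmaSubtype fun x y => W.toAffine.Equation x y),
      Nat.card_sigma]
  have h3 : ∀ x : K, ((Nat.card {y : K // W.toAffine.Equation x y} : ℕ) : K) =
      1 + (W.twoTorsionPolynomial.toPoly ^ (Fintype.card K / 2)).eval x := fun x => by
    rw [W.card_equation_fibre_eq h2, cast_card_sqrts h2, eval_pow]
  rw [h1, Nat.cast_sum]
  simp only [h3, sum_add_distrib, sum_const, card_univ, nsmul_eq_mul, mul_one,
    FiniteField.cast_card_eq_zero, zero_add]
  rw [sum_eval_eq_neg_coeff, hhalf]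
  calc (W.twoTorsionPolynomial.toPoly ^ (Fintype.card K / 2)).natDegree
      ≤ Fintype.card K / 2 * W.twoTorsionPolynomial.toPoly.natDegree := natDegree_pow_le
    _ ≤ Fintype.card K / 2 * 3 := Nat.mul_le_mul_left _ natDegree_cubic_le
    _ < 2 * (Fintype.card K - 1) := by omega

/-- **Silverman AEC V.4.1(a): `#E(𝔽_q) = 1 - A_q` as an equality in `𝔽_q`** for an elliptic curve
over a finite field of odd characteristic (`#E(𝔽_q) = Nat.card W.toAffine.Point`, the affine points
— all nonsingular — plus `O`; `A_q` = coefficient of `x^{q-1}` in `Ψ₂²(x)^{(q-1)/2}`).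
[cite: SilvermanAEC2009, V.4.1] -/
theorem cast_natCard_point_eq [W.IsElliptic] (h2 : ringChar K ≠ 2) :
    (Nat.card W.toAffine.Point : K) =
      1 - (W.twoTorsionPolynomial.toPoly ^ ((Fintype.card K - 1) / 2)).coeff (Fintype.card K - 1) := by
  have h : Nat.card W.toAffine.Point = Nat.card {xy : K × K // W.toAffine.Equation xy.1 xy.2} + 1 := by
    rw [Nat.card_congr W.toAffine.pointEquiv]
    exact Finite.card_option
  rw [h, Nat.cast_add, Nat.cast_one, W.cast_natCard_equation_eq h2]
  ring

/-- **The trace of Frobenius is the Hasse invariant mod `p`**: `a = q + 1 - #E(𝔽_q)` satisfies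
`a = A_q` in `𝔽_q` ("`a = A_q` as an equality in `𝔽_q`"; hence `a ≡ 0 (mod p) ↔ A_q = 0`, i.e.
supersingular). [Silverman AEC V.4.1(a) (proof)] [cite: SilvermanAEC2009, V.4.1] -/
theorem cast_card_add_one_sub_natCard_point [W.IsElliptic] (h2 : ringChar K ≠ 2) :
    (((Fintype.card K : ℤ) + 1 - Nat.card W.toAffine.Point : ℤ) : K) =
      (W.twoTorsionPolynomial.toPoly ^ ((Fintype.card K - 1) / 2)).coeff (Fintype.card K - 1) := by
  push_cast
  rw [W.cast_natCard_point_eq h2, FiniteField.cast_card_eq_zero]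
  ring

end WeierstrassCurve
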